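import Mathlib
import HarnessLib
import Literature.MathematicalPhysics.QuantumFieldTheory.YangMillsOS
import Summits.QuantumFields.YangMills.Theorems.MirrorModularBoostsHypercubicLimitSubschemeDefs

/-!
# Line `Sketch` (coupling response): the imported infrared inputs `IRInputs` (Defs E)

Definitions file for crux `stmt-QuantumFields-16154` (`HypercubicLimit`), line `Sketch`.  `IRInputs r sch` was kept provisional in
the skeleton by lead -0; after the c2 seat's audit (report `Lines/Sketch-c2-cycle1.md` §3b.4: the sup-norm thermal term of clause (b)
is usable once the scheme has polynomial volume growth and renormalisation, both now conjuncts of the line's input) it is fixed here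
VERBATIM, so that closure stubs can name it and its restriction to sub-schemes (`irInputs_subseq`) is a tree fact.
(a) the crux's own `HasLatticeMassGap`; (b) RP-spectral relative clustering of reflected slab functionals at rate `Δ a_k` per lattice
time step on every torus at least the scheme's, thermal error `C B² e^{−Δ a_k S}`; (c) a non-triviality floor; (d) a `κ₃` floor.
Nothing is asserted.
-/

noncomputable section

open scoped SchwartzMap
open MeasureTheory Filter Topology
open Literature.MathematicalPhysics.AQFT Literature.MathematicalPhysics.QuantumLattice
open Literature.MathematicalPhysics.QuantumFieldTheory

namespace Summit.QuantumFields.YangMills.Cruxes.HypercubicLimit.CouplingResponse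

section Objects

variable {G : Type} [Group G] [TopologicalSpace G] [IsTopologicalGroup G] [CompactSpace G]
  [MeasurableSpace G] [BorelSpace G]

/-- **The imported INFRARED inputs along the scheme** (open; every passing line on this directory
imports them): (a) the crux's own uniform lattice gap clause `HasLatticeMassGap r sch Δ` (all pairs of
local gauge observables, uniform in the volume); (b) its RP-SPECTRAL form on the scheme's couplings —
relative clustering of reflected slab functionals at rate `Δ a_k` per lattice time step on every torus at
least the scheme's, with the thermal (periodic-image) error `C B² e^{−Δ a_k S}` (what `spec T ⊆ {1} ∪
[0, e^{−Δ a_k}]` gives; scale-free, so it survives the multiplicative renormalisation `c_k` and feeds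
E4/`HasMassGap` of the limit); (c) a NON-TRIVIALITY FLOOR: for one real pair `u` (negative times), `v`
(positive times) the truncated lattice two-point function of the curvature stays `≥ δ > 0` in size for
all large `k` (`liminf` form, so it survives subsequences; cf. `twoPointNontrivial_iff_lattice`);
(d) a `κ₃` FLOOR: for one pairwise disjoint real triple the lattice third cumulant of the curvature stays
`≥ δ > 0` in size for all large `k`. [folklore] -/
def IRInputs (r : LatticeRep G) (sch : SpeciesScheme (YMSpecies G)) : Prop :=
  (∃ Δ C : ℝ, 0 < Δ ∧ HasLatticeMassGap r sch Δ ∧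
    ∀ᶠ k in atTop, ∀ (S T n : ℕ), sch.L k ≤ S → 2 * (T + n + 1) ≤ S →
      ∀ (Y : LGConfig 4 G → ℝ) (B : ℝ), Measurable Y → (∀ U, |Y U| ≤ B) →
        DependsOn Y {e : Literature.MathematicalPhysics.QuantumLattice.ZdEdge 4 |
          1 ≤ e.1 0 ∧ e.1 0 + (if e.2 = 0 then 1 else 0) ≤ T} →
          |(∫ U, Y (torusLift (2 * S + 1) (GaugeConfig.timeReflect U)) *
                Y (configShift (-Pi.single 0 (n : ℤ)) (torusLift (2 * S + 1) U))
              ∂(wilsonMeasure r.ρ (sch.β k) : Measure (GaugeConfig 4 (2 * S + 1) G))) -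
            (∫ U, Y (torusLift (2 * S + 1) U)
              ∂(wilsonMeasure r.ρ (sch.β k) : Measure (GaugeConfig 4 (2 * S + 1) G))) ^ 2| ≤
            Real.exp (-(Δ * sch.a k * n)) *
              ((∫ U, Y (torusLift (2 * S + 1) (GaugeConfig.timeReflect U)) * Y (torusLift (2 * S + 1) U)
                  ∂(wilsonMeasure r.ρ (sch.β k) : Measure (GaugeConfig 4 (2 * S + 1) G))) -
                (∫ U, Y (torusLift (2 * S + 1) U)
                  ∂(wilsonMeasure r.ρ (sch.β k) : Measure (GaugeConfig 4 (2 * S + 1) G))) ^ 2) +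
            C * B ^ 2 * Real.exp (-(Δ * sch.a k * S))) ∧
  (∃ (u v : 𝓢(EuclideanSpace ℝ (Fin 4), ℝ)) (δ : ℝ),
    tsupport u ⊆ {y : EuclideanSpace ℝ (Fin 4) | y 0 < 0} ∧
    tsupport v ⊆ {y : EuclideanSpace ℝ (Fin 4) | 0 < y 0} ∧ 0 < δ ∧
    ∀ᶠ k in atTop, δ ≤
      |latticeSchwinger r.ρ sch (fun s => s.F) k (1 + 1) (fun _ => r.curvature) ![u, v] -
        latticeSchwinger r.ρ sch (fun s => s.F) k 1 (fun _ => r.curvature) ![u] *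
          latticeSchwinger r.ρ sch (fun s => s.F) k 1 (fun _ => r.curvature) ![v]|) ∧
  (∃ (f g h : 𝓢(EuclideanSpace ℝ (Fin 4), ℝ)) (δ : ℝ),
    Disjoint (tsupport f) (tsupport g) ∧ Disjoint (tsupport f) (tsupport h) ∧
    Disjoint (tsupport g) (tsupport h) ∧ 0 < δ ∧
    ∀ᶠ k in atTop, δ ≤
      |latticeSchwinger r.ρ sch (fun s => s.F) k 3 (fun _ => r.curvature) ![f, g, h] -
        latticeSchwinger r.ρ sch (fun s => s.F) k 1 (fun _ => r.curvature) ![f] *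
          latticeSchwinger r.ρ sch (fun s => s.F) k 2 (fun _ => r.curvature) ![g, h] -
        latticeSchwinger r.ρ sch (fun s => s.F) k 1 (fun _ => r.curvature) ![g] *
          latticeSchwinger r.ρ sch (fun s => s.F) k 2 (fun _ => r.curvature) ![f, h] -
        latticeSchwinger r.ρ sch (fun s => s.F) k 1 (fun _ => r.curvature) ![h] *
          latticeSchwinger r.ρ sch (fun s => s.F) k 2 (fun _ => r.curvature) ![f, g] +
        2 * (latticeSchwinger r.ρ sch (fun s => s.F) k 1 (fun _ => r.curvature) ![f] *
          latticeSchwinger r.ρ sch (fun s => s.F) k 1 (fun _ => r.curvature) ![g] *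
          latticeSchwinger r.ρ sch (fun s => s.F) k 1 (fun _ => r.curvature) ![h])|)

end Objects

/-- **Registered sub-goal `irInputs_subseq` (line `Sketch`, closure bookkeeping)**: the infrared inputs restrict to every
sub-scheme (every clause is eventual in `k` or reads the scheme's data at `k`). [folklore] -/
theorem irInputs_subseq :
    ∀ (G : Type) [Group G] [TopologicalSpace G] [IsTopologicalGroup G] [CompactSpace G] [MeasurableSpace G] [BorelSpace G] (r : LatticeRep G) (sch : SpeciesScheme (YMSpecies G)) (φ : ℕ → ℕ) (hφ : StrictMono φ), IRInputs r sch → IRInputs r (subseq sch φ hφ) := by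
  intro G _ _ _ _ _ _ r sch φ hφ h
  obtain ⟨⟨Δ, C, hΔ, hgap, hb⟩, ⟨u, v, δ, hu, hv, hδ, hc⟩, ⟨f, g, h3, δ', hfg, hfh, hgh, hδ', hd⟩⟩ := h
  refine ⟨⟨Δ, C, hΔ, hasLatticeMassGap_subseq r sch φ hφ hgap, eventually_subseq hφ hb⟩,
    ⟨u, v, δ, hu, hv, hδ, eventually_subseq hφ hc⟩, ⟨f, g, h3, δ', hfg, hfh, hgh, hδ', eventually_subseq hφ hd⟩⟩

end Summit.QuantumFields.YangMills.Cruxes.HypercubicLimit.CouplingResponse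

end
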